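import Literature.NumberTheory.PAdicHodge.DualExpElliptic
import HarnessLib

set_option autoImplicit false
set_option linter.dupNamespace false

/-!
# (A2) is self-normalising — the Tate-duality clause pins the de Rham generator `d` to the Néron class up to
# `ℤ_pˣ` (ideator bsd-idea-20 g70, crux `EllipticUnitValueSevenOfGZK` = `stmt-BirchSwinnertonDyer-19945`,
# route `RamifiedSevenEllipticUnits` (K7r); input to the pen's question Q-E2b of ruling D981)

Companion kernel file of the memo `Cruxes/EllipticUnitValueSevenOfGZK/A2SelfNormalising-g70.md`.
Imports `Literature` + `HarnessLib` only (no `Cruxes`/`Theses` module), `sorry`-free.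

THE POINT.  In the letters `Kato2004.MemberRealisationPrintBody` / `MemberRealisationBody` (F•′ / F•) the
de Rham generator `d` of `D⁰_dR(V_pW|_{Γ_{ℚ_v}})` in which the value functional `Λ = exp*_d` is read is NOT
free: clause (R1).2 = (A2) says that the range of `expStarCoord W hv d` on the continuous cocycles
`Γ_{ℚ_v} → T_pW` is EXACTLY the trace-dual `𝔏^⊥ = {a : ‖a · log_ω Q‖ ≤ 1 ∀ Q ∈ W(ℚ_p)}` of the Néron
logarithm lattice `𝔏 = log_ω(W(ℚ_p))` (`padicLogLocal W p` = the formal logarithm of the globally minimal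
model, i.e. of a Néron differential).  Two consequences, proved here in the kernel:

* §1–§2 (RIGIDITY) any two generators `d, d'` whose `exp*`-coordinates have the SAME range `S`, where `S`
  possesses an element of maximal size (every dual lattice `𝔏^⊥ = p^{-m} ℤ_p` does, §3), differ by a scalar
  of size `1`: `d'.ω = e • d.ω`, `N e = 1` (`FilZeroLine.exists_ne_zero_and_eq_smul` + the scale law
  `exp*_{e•ω} = e⁻¹ exp*_ω`, tree `FilZeroLine.dualExpCoord_smul`).  Hence the (A2)-admissible generators
  form ONE `ℤ_pˣ`-orbit; since the Néron class `[ω_W]` is (A2)-admissible IN PRINT (Kato LNM 1553 II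
  Thm 1.4.1 (3)(4) + Ex. 1.3.5; Bloch–Kato Prop. 3.8 (integral form) + Ex. 3.11; stated outright for additive
  reduction by Kim–Nakamura, arXiv:1808.07726 §2.1 Cor. 2.4 — the print behind the tree's named fact (S5b)
  `exists_smul_range_expStarCoord_iff_trace_log`), EVERY witness `d` of F•′/F• satisfies
  `v_p(d : ω_W) = 0` — the caveat (A2) of memos g67 §4.2 (e) / g69 §4 is a THEOREM of the clause, at every
  prime including the additive prime `7` of the class `𝒞₇`, not an assumption.
* §4 (EXPONENT TRANSFER) value constants `q, q' ∈ ℚ` of two witnesses related by such a unit have the same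
  `p`-adic valuation, so the (R3c) exponent `v_p(ϖ/(q·q⁻))` is witness-independent.

§3 shows that the letter's dual set `{a : ℚ_p | ∀ i, ‖a · L i‖ ≤ 1}` (any bounded family `L` with a
non-zero value — `L = log_ω` on `W(ℚ_p)`) has an element of maximal norm, so §1–§2 apply verbatim, also
through a ring isomorphism `ι : E ≃+* ℚ_[p]` (the letter's `(Padic.adicCompletionEquiv …).symm`).

HONEST LABEL: kernel algebra about the letters; nothing here proves `hR3c`, (E2), K1ᵘ, K2ᶜ, Conj. 12.10,
`X12.CMRamifiedSeven` or BSD; crux 19945 stays OPEN.  No statement of the skeleton is touched.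

References: [Kato1993LNM1553, Ch. II Ex. 1.3.5, Thm. 1.4.1 (3)(4), Lemma 1.4.3–1.4.5];
[BlochKato1990, Prop. 3.8 (p. 354), Example 3.11 (3.11.1)–(3.11.2) (p. 361)];
[KimNakamura2020 = arXiv:1808.07726, §2.1 Thm. 2.1, Prop. 2.2, Cor. 2.3, Cor. 2.4, Assumption 2.5];
[SilvermanAEC2009, IV.6.4, VII.2.2].
-/

noncomputable section

open scoped TensorProduct NNReal Pointwise
open Field ValuativeRel
open Literature.NumberTheory.GaloisRepresentations
open Literature.NumberTheory.GaloisRepresentations.PeriodRingData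
open Literature.NumberTheory.GaloisRepresentations.IsNonarchimedeanLocalField
open Literature.NumberTheory.PAdicHodge
open Literature.NumberTheory.EllipticCurves WeierstrassCurve

namespace Summit.BirchSwinnertonDyer.BirchSwinnertonDyer.Cruxes.EllipticUnitValueSevenOfGZK.A2SelfNormalising

/-! ## §1 Rigidity of a set with an element of maximal size under rescaling (pure algebra) -/

section Rigidity

variable {E : Type*} [Field E]

/-- **Rigidity.** If `S ⊆ E` contains a non-zero element `a₀` of maximal size (for a multiplicative size
function `N ≥ 0`) and `e • S = S`, then `N e = 1`.  (Applied to `S = 𝔏^⊥`, a dual lattice in `ℚ_p`.)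
[folklore] -/
theorem size_eq_one_of_smul_set_eq (N : E →*₀ ℝ) (hN : ∀ x, 0 ≤ N x) {S : Set E} {a₀ : E}
    (ha₀S : a₀ ∈ S) (ha₀ : a₀ ≠ 0) (hmax : ∀ a ∈ S, N a ≤ N a₀) {e : E} (he : e • S = S) :
    N e = 1 := by
  have hNa₀ : 0 < N a₀ := lt_of_le_of_ne (hN a₀) (Ne.symm ((map_ne_zero N).mpr ha₀))
  -- `e • a₀ ∈ S`, so `N e * N a₀ ≤ N a₀`
  have h1 : e • a₀ ∈ S := by rw [← he]; exact Set.smul_mem_smul_set ha₀S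
  have hle : N e ≤ 1 := by
    have h := hmax _ h1
    rw [smul_eq_mul, map_mul] at h
    exact le_of_mul_le_mul_right (by simpa using h) hNa₀
  -- `a₀ = e • b` with `b ∈ S`, so `N b ≤ N a₀ = N e * N b`
  obtain ⟨b, hbS, hb⟩ : ∃ b ∈ S, e • b = a₀ := by
    have h : a₀ ∈ e • S := by rw [he]; exact ha₀S
    exact Set.mem_smul_set.mp h
  have hb0 : b ≠ 0 := by
    rintro rfl
    exact ha₀ (by rw [← hb, smul_zero])
  have hNb : 0 < N b := lt_of_le_of_ne (hN b) (Ne.symm ((map_ne_zero N).mpr hb0))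
  have hge : 1 ≤ N e := by
    have h := hmax b hbS
    rw [← hb, smul_eq_mul, map_mul] at h
    exact le_of_mul_le_mul_right (by simpa using h) hNb
  exact le_antisymm hle hge

/-- **Rigidity for two functionals with the same range.**  If `φ : H → E` and its rescaling
`h ↦ e⁻¹ · φ h` (`e ≠ 0`) have the SAME range `S`, and `S` has a non-zero element of maximal size, then
`N e = 1`.  (`φ = exp*_d`, `e⁻¹ φ = exp*_{e•d}`.) [folklore] -/
theorem size_eq_one_of_range_eq (N : E →*₀ ℝ) (hN : ∀ x, 0 ≤ N x) {H : Type*} (φ : H → E)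
    {e : E} (he : e ≠ 0) {S : Set E} {a₀ : E} (ha₀S : a₀ ∈ S) (ha₀ : a₀ ≠ 0)
    (hmax : ∀ a ∈ S, N a ≤ N a₀) (hφ : Set.range φ = S)
    (hψ : Set.range (fun h => e⁻¹ * φ h) = S) : N e = 1 := by
  have hS : e • S = S := by
    ext a
    constructor
    · rintro ⟨b, hb, rfl⟩
      rw [← hψ] at hb
      obtain ⟨h, rfl⟩ := hb
      rw [← hφ]
      exact ⟨h, by simp [smul_eq_mul, mul_inv_cancel_left₀ he]⟩
    · intro ha
      rw [← hφ] at ha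
      obtain ⟨h, rfl⟩ := ha
      refine Set.mem_smul_set.mpr ⟨e⁻¹ * φ h, ?_, by simp [smul_eq_mul, mul_inv_cancel_left₀ he]⟩
      rw [← hψ]
      exact ⟨h, rfl⟩
  exact size_eq_one_of_smul_set_eq N hN ha₀S ha₀ hmax hS

end Rigidity

/-! ## §2 The (A2)-admissible generators of `D⁰_dR(V_pW|_{Γ_F})` form one orbit under scalars of size `1` -/

section ExpStar

variable {K₀ : Type} [Field K₀] (W : WeierstrassCurve K₀) [W.IsElliptic]
  {F : Type} [Field F] [Algebra K₀ F] [ValuativeRel F] [TopologicalSpace F]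
  [IsNonarchimedeanLocalField F] [CharZero F] {p : ℕ} [Fact p.Prime]
  [Fact (¬ IsUnit (p : integerC F))] [IsAdicComplete (Ideal.span {(p : integerC F)}) (integerC F)]
  (hp : valuation F p < 1) [Algebra ℚ_[p] F]

/-- **Scale law `exp*_{e•d}(η) = e⁻¹ · exp*_d(η)`** for the tree's `expStarCoord` (definitionally
`dualExpCoord` along `d.ω`; the tree's `FilZeroLine.dualExpCoord_smul`).
[cite: Kato1993LNM1553, Ch. II §1.2.4 and Ex. 1.3.5] -/
theorem expStarCoord_smul
    (d : (bdRPeriodRingData (F := F) (p := p) hp).FilZeroLine (restrictedRationalTateRep W F p))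
    {e : F} (he : e ≠ 0) (η : contOneCocycles (restrictedTateRep W F p).toTopRep) :
    expStarCoord W hp (d.smul e he) η = e⁻¹ * expStarCoord W hp d η := by
  unfold expStarCoord
  rw [FilZeroLine.smul_ω]
  exact FilZeroLine.dualExpCoord_smul d he _

/-- `expStarCoord` depends on the datum only through its vector `d.ω`. [folklore] -/
theorem expStarCoord_congr_ω
    (d d' : (bdRPeriodRingData (F := F) (p := p) hp).FilZeroLine (restrictedRationalTateRep W F p))
    (h : d'.ω = d.ω) (η : contOneCocycles (restrictedTateRep W F p).toTopRep) :
    expStarCoord W hp d' η = expStarCoord W hp d η := by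
  unfold expStarCoord
  rw [h]

/-- **(A2) is self-normalising.**  Let `d, d'` be generators of the `F`-line `D⁰_dR(V_pW|_{Γ_F})` whose
scalar dual exponentials `exp*_d`, `exp*_{d'}` have the SAME range `S ⊆ F` on the continuous cocycles
`Γ_F → T_pW` (e.g. both satisfy the Tate-duality clause (A2) of `Kato2004.MemberRealisation(Print)Body`,
`S = 𝔏^⊥` the trace-dual of the Néron logarithm lattice), and let `S` possess a non-zero element of maximal
size for a multiplicative size function `N ≥ 0` on `F` (for `S = 𝔏^⊥ ⊂ ℚ_p` see §3).  Then `d' = e • d`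
with `N e = 1`: the clause pins the generator up to scalars of size one — in particular to the Néron class
`[ω_W]`, which satisfies (A2) in print (Kato LNM 1553 II Thm. 1.4.1 (3)(4) with Ex. 1.3.5; Bloch–Kato
Prop. 3.8 integral form + Ex. 3.11 (3.11.1); for additive reduction Kim–Nakamura Cor. 2.4), up to `ℤ_pˣ`.
[cite: Kato1993LNM1553, Ch. II Ex. 1.3.5, Thm. 1.4.1 (3)(4), Lemma 1.4.3–1.4.5]
[cite: BlochKato1990, Prop. 3.8 (p. 354), Example 3.11 (3.11.1)–(3.11.2) (p. 361)]
[cite: KimNakamura2020, §2.1 Cor. 2.4 (arXiv:1808.07726)] -/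
theorem exists_scale_size_eq_one_of_range_expStarCoord_eq (N : F →*₀ ℝ) (hN : ∀ x, 0 ≤ N x)
    (d d' : (bdRPeriodRingData (F := F) (p := p) hp).FilZeroLine (restrictedRationalTateRep W F p))
    {S : Set F} {a₀ : F} (ha₀S : a₀ ∈ S) (ha₀ : a₀ ≠ 0) (hmax : ∀ a ∈ S, N a ≤ N a₀)
    (hd : Set.range (expStarCoord W hp d) = S) (hd' : Set.range (expStarCoord W hp d') = S) :
    ∃ e : F, e ≠ 0 ∧ d'.ω = e • d.ω ∧ N e = 1 := by
  obtain ⟨e, he, hω⟩ := FilZeroLine.exists_ne_zero_and_eq_smul d d'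
  refine ⟨e, he, hω, ?_⟩
  have hψ : Set.range (fun η => e⁻¹ * expStarCoord W hp d η) = S := by
    have hfun : (fun η => e⁻¹ * expStarCoord W hp d η) = expStarCoord W hp d' := by
      funext η
      rw [← expStarCoord_smul W hp d he η]
      exact (expStarCoord_congr_ω W hp (d.smul e he) d' (by rw [hω, FilZeroLine.smul_ω]) η).symm
    rw [hfun, hd']
  exact size_eq_one_of_range_eq N hN (expStarCoord W hp d) he ha₀S ha₀ hmax hd hψ

end ExpStar

/-! ## §3 The dual set `𝔏^⊥ = {a : ‖a · L i‖ ≤ 1 ∀ i}` in `ℚ_p` has an element of maximal norm -/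

section DualSet

variable {p : ℕ} [Fact p.Prime]

/-- In `ℚ_p` the norm of a non-zero element is an integral power of `p`. [folklore] -/
theorem exists_norm_eq_zpow {x : ℚ_[p]} (hx : x ≠ 0) : ∃ k : ℤ, ‖x‖ = (p : ℝ) ^ k :=
  ⟨-x.valuation, Padic.norm_eq_zpow_neg_valuation hx⟩

/-- **A closed ball of positive radius in `ℚ_p` has an element of maximal norm**, namely a power of `p`.
[folklore] -/
theorem exists_max_norm_of_closedBall {R : ℝ} (hR : 0 < R) :
    ∃ a₀ : ℚ_[p], a₀ ≠ 0 ∧ ‖a₀‖ ≤ R ∧ ∀ a : ℚ_[p], ‖a‖ ≤ R → ‖a‖ ≤ ‖a₀‖ := by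
  have hp1 : (1 : ℝ) < p := mod_cast (Fact.out : p.Prime).one_lt
  have hp0 : (0 : ℝ) < p := lt_trans zero_lt_one hp1
  -- the admissible exponents `k` with `p ^ k ≤ R` have a greatest element
  obtain ⟨m, hm⟩ := pow_unbounded_of_one_lt R hp1
  have Hbdd : ∃ b : ℤ, ∀ z : ℤ, (p : ℝ) ^ z ≤ R → z ≤ b := by
    refine ⟨m, fun z hz => ?_⟩
    by_contra h
    push Not at h
    have : (p : ℝ) ^ (m : ℤ) < (p : ℝ) ^ z := zpow_lt_zpow_right₀ hp1 h
    rw [zpow_natCast] at this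
    linarith
  obtain ⟨n, hn⟩ := exists_pow_lt_of_lt_one hR (inv_lt_one_of_one_lt₀ hp1)
  have Hinh : ∃ z : ℤ, (p : ℝ) ^ z ≤ R := by
    refine ⟨-(n : ℤ), ?_⟩
    rw [zpow_neg, zpow_natCast, ← inv_pow]
    exact hn.le
  obtain ⟨k, hk, hkmax⟩ := Int.exists_greatest_of_bdd (P := fun z : ℤ => (p : ℝ) ^ z ≤ R) Hbdd Hinh
  refine ⟨(p : ℚ_[p]) ^ (-k), zpow_ne_zero _ (by exact_mod_cast (Fact.out : p.Prime).ne_zero), ?_, ?_⟩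
  · rw [Padic.norm_p_zpow, neg_neg]
    exact hk
  · intro a ha
    rw [Padic.norm_p_zpow, neg_neg]
    rcases eq_or_ne a 0 with rfl | ha0
    · rw [norm_zero]
      exact (zpow_pos hp0 k).le
    · obtain ⟨j, hj⟩ := exists_norm_eq_zpow ha0
      rw [hj] at ha ⊢
      exact zpow_le_zpow_right₀ hp1.le (hkmax j ha)

/-- **The letter's dual set has an element of maximal norm.**  For a bounded family `L : ι → ℚ_p` with a
non-zero value (`L = log_ω` on `W(ℚ_p)`: bounded since `W(ℚ_p)` is compact / `log_ω(W(ℚ_p)) ⊆ p^{-c}ℤ_p`,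
non-zero on the formal group), the set `S = {a : ∀ i, ‖a · L i‖ ≤ 1}` is a closed ball of positive radius and
hence has a non-zero element of maximal norm.  [folklore] -/
theorem exists_max_norm_of_dualSet {ι : Type*} (L : ι → ℚ_[p]) {C : ℝ} (hC : ∀ i, ‖L i‖ ≤ C)
    {i₀ : ι} (hi₀ : L i₀ ≠ 0) :
    ∃ a₀ : ℚ_[p], a₀ ≠ 0 ∧ (∀ i, ‖a₀ * L i‖ ≤ 1) ∧
      ∀ a : ℚ_[p], (∀ i, ‖a * L i‖ ≤ 1) → ‖a‖ ≤ ‖a₀‖ := by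
  have hp1 : (1 : ℝ) < p := mod_cast (Fact.out : p.Prime).one_lt
  have hp0 : (0 : ℝ) < p := lt_trans zero_lt_one hp1
  -- the exponents of the non-zero values of `L` have a greatest element `k₁`
  have hC0 : 0 < C := lt_of_lt_of_le (norm_pos_iff.mpr hi₀) (hC i₀)
  obtain ⟨m, hm⟩ := pow_unbounded_of_one_lt C hp1
  obtain ⟨k₁, ⟨i₁, hi₁, hk₁⟩, hk₁max⟩ := Int.exists_greatest_of_bdd
    (P := fun z : ℤ => ∃ i, L i ≠ 0 ∧ ‖L i‖ = (p : ℝ) ^ z)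
    ⟨m, fun z ⟨i, _, hz⟩ => by
      by_contra h
      push Not at h
      have h1 : (p : ℝ) ^ (m : ℤ) < (p : ℝ) ^ z := zpow_lt_zpow_right₀ hp1 h
      rw [zpow_natCast] at h1
      linarith [hC i]⟩
    ⟨-(L i₀).valuation, i₀, hi₀, Padic.norm_eq_zpow_neg_valuation hi₀⟩
  -- `S` is the closed ball of radius `p^{-k₁}`
  have hS : ∀ a : ℚ_[p], (∀ i, ‖a * L i‖ ≤ 1) ↔ ‖a‖ ≤ (p : ℝ) ^ (-k₁) := by
    intro a
    constructor
    · intro h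
      have h1 := h i₁
      rw [norm_mul, hk₁] at h1
      rw [zpow_neg]
      exact (le_inv_mul_iff₀' (zpow_pos hp0 k₁)).mpr (by simpa using h1) |>.trans (by simp)
    · intro ha i
      rcases eq_or_ne (L i) 0 with hLi | hLi
      · simp [hLi]
      · obtain hz := hk₁max (-(L i).valuation) ⟨i, hLi, Padic.norm_eq_zpow_neg_valuation hLi⟩
        rw [norm_mul, Padic.norm_eq_zpow_neg_valuation hLi]
        calc ‖a‖ * (p : ℝ) ^ (-(L i).valuation)
            ≤ (p : ℝ) ^ (-k₁) * (p : ℝ) ^ k₁ := by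
              apply mul_le_mul ha (zpow_le_zpow_right₀ hp1.le hz) (zpow_pos hp0 _).le (zpow_pos hp0 _).le
          _ = 1 := by rw [← zpow_add₀ hp0.ne', neg_add_cancel, zpow_zero]
  obtain ⟨a₀, ha₀, ha₀R, hmax⟩ := exists_max_norm_of_closedBall (p := p) (zpow_pos hp0 (-k₁))
  exact ⟨a₀, ha₀, (hS a₀).mpr ha₀R, fun a ha => hmax a ((hS a).mp ha)⟩

/-- **Rigidity of the letter's dual set, through a ring isomorphism `ι : E ≃+* ℚ_p`** (the letter reads the
norm of `a : ℚ_v` in `ℚ_p` through `(Padic.adicCompletionEquiv …).symm`).  If `φ : H → E` and `h ↦ e⁻¹ φ h`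
both have range `{a : ∀ i, ‖ι a · L i‖ ≤ 1}` for a bounded family `L` with a non-zero value, then
`‖ι e‖ = 1`.  With `φ = exp*_d`, `e⁻¹φ = exp*_{e•d}` (§2 `expStarCoord_smul`) this is the statement
«two (A2)-admissible generators differ by a `p`-adic unit». [folklore] -/
theorem norm_scale_eq_one_of_dualRange_eq {E : Type*} [Field E] (ι : E ≃+* ℚ_[p]) {H ι' : Type*}
    (φ : H → E) {e : E} (he : e ≠ 0) (L : ι' → ℚ_[p]) {C : ℝ} (hC : ∀ i, ‖L i‖ ≤ C) {i₀ : ι'}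
    (hi₀ : L i₀ ≠ 0) (hφ : Set.range φ = {a | ∀ i, ‖ι a * L i‖ ≤ 1})
    (hψ : Set.range (fun h => e⁻¹ * φ h) = {a | ∀ i, ‖ι a * L i‖ ≤ 1}) : ‖ι e‖ = 1 := by
  obtain ⟨b₀, hb₀, hb₀S, hmax⟩ := exists_max_norm_of_dualSet L hC hi₀
  let N : E →*₀ ℝ := (normHom : ℚ_[p] →*₀ ℝ).comp (ι : E →+* ℚ_[p]).toMonoidWithZeroHom
  have hN : ∀ x, 0 ≤ N x := fun x => by
    show 0 ≤ ‖(ι : E →+* ℚ_[p]) x‖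
    exact norm_nonneg _
  have hNe : N e = ‖ι e‖ := rfl
  rw [← hNe]
  refine size_eq_one_of_range_eq N hN φ he (a₀ := ι.symm b₀) (S := {a | ∀ i, ‖ι a * L i‖ ≤ 1})
    (by simpa using hb₀S) (by simpa using hb₀) (fun a ha => ?_) hφ hψ
  show ‖ι a‖ ≤ ‖ι (ι.symm b₀)‖
  rw [RingEquiv.apply_symm_apply]
  exact hmax (ι a) ha

end DualSet

/-! ## §4 Exponent transfer: unit-related rational value constants have the same valuation -/

section Exponent

variable {p : ℕ} [Fact p.Prime]

/-- A `p`-adic number of norm `1` has valuation `0`. [folklore] -/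
theorem valuation_eq_zero_of_norm_eq_one {e : ℚ_[p]} (he : ‖e‖ = 1) : e.valuation = 0 := by
  have he0 : e ≠ 0 := by
    rintro rfl
    simp at he
  have h := Padic.norm_eq_zpow_neg_valuation he0
  rw [he] at h
  have hp1 : (1 : ℝ) < p := mod_cast (Fact.out : p.Prime).one_lt
  have : (p : ℝ) ^ (0 : ℤ) = (p : ℝ) ^ (-e.valuation) := by rw [zpow_zero]; exact h
  have hinj := (zpow_right_strictMono₀ hp1).injective this
  omega

/-- **Exponent transfer.**  If the rational value constants `q, q'` of two witnesses are related by a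
`p`-adic unit, `q' = e · q` in `ℚ_p` with `‖e‖ = 1` (two (A2)-admissible coordinates, §2–§3), then
`v_p(q') = v_p(q)`; hence the (R3c) exponents `v_p(ϖ/(q·q⁻))` and `v_p(ϖ/(q'·q⁻))` coincide. [folklore] -/
theorem padicValRat_eq_of_unit_mul {q q' : ℚ} (hq : q ≠ 0) {e : ℚ_[p]} (he : ‖e‖ = 1)
    (h : ((q' : ℚ) : ℚ_[p]) = e * (q : ℚ_[p])) : padicValRat p q' = padicValRat p q := by
  have he0 : e ≠ 0 := by
    rintro rfl
    simp at he
  have hqp : (q : ℚ_[p]) ≠ 0 := by exact_mod_cast hq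
  have := congrArg Padic.valuation h
  rw [Padic.valuation_ratCast, Padic.valuation_mul he0 hqp, valuation_eq_zero_of_norm_eq_one he,
    zero_add, Padic.valuation_ratCast] at this
  exact this

/-- The (R3c) exponent is invariant under unit-related value constants. [folklore] -/
theorem r3cExponent_eq_of_unit_mul {q q' qm perRatio : ℚ} (hq : q ≠ 0) {e : ℚ_[p]} (he : ‖e‖ = 1)
    (h : ((q' : ℚ) : ℚ_[p]) = e * (q : ℚ_[p])) (hq' : q' ≠ 0) (hqm : qm ≠ 0) (hϖ : perRatio ≠ 0) :
    padicValRat p (perRatio / (q' * qm)) = padicValRat p (perRatio / (q * qm)) := by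
  rw [padicValRat.div hϖ (mul_ne_zero hq' hqm), padicValRat.div hϖ (mul_ne_zero hq hqm),
    padicValRat.mul hq' hqm, padicValRat.mul hq hqm, padicValRat_eq_of_unit_mul hq he h]

end Exponent

end Summit.BirchSwinnertonDyer.BirchSwinnertonDyer.Cruxes.EllipticUnitValueSevenOfGZK.A2SelfNormalising

end
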